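import Mathlib
import HarnessLib
import Summits.NavierStokesRegularity.FluidComputer.TriggeredTransferH1Seeded
import Literature.Analysis.FluidPDE.SuitableWeak

/-!
# The blow-up of a cascade is a SINGULAR TIME at the limit centre, and is TYPE II as soon as the
# transfers take a fixed fraction of a turnover (door N1-FC, analysis half: the Seregin dictionary)

Cell `ns-blowup`, seat `ns-blowup-fc-prover-1` (g6; D-0074 GROUP C «bridge support», door N1-FC).
Companion of `TriggeredTransferCascadeWitness.lean` (g5): a cascade `ρ : 𝒮.Cascade ν` of triggered
transfers (`ν > 0`) is glued there into an exact forced classical solution `ρ.limitVel hν` on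
`[0, T*)`, `T* = ρ.Tstar`, closing on Fefferman's (C) fact-free. This file reads that witness in the
vocabulary of `Literature/Analysis/FluidPDE/SuitableWeak.lean` (CKN regular points; Seregin 2012, §1:
singular time, Type I rate `‖u(t, x)‖ ≤ C/√(T - t)`, Type II = singular ∧ ¬ Type I). LABEL: E–C
bookkeeping (real analysis over the TYPE `Cascade`). WHAT THIS IS NOT: not Navier–Stokes evidence and
not a construction — `Cascade ν` is inhabited in the tree only under the OPEN door predicates
(`TriggerScheme.Transfers`, `TriggerSchemeH1.Transfers{,Seeded}`), asserted nowhere; no scheme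
instance, cascade, transfer or blow-up is claimed; nothing here is an item of any route.

* `Cascade.limitCentre ρ = Σ' k, (mag k)⁻¹ • x₀_k` — THE BLOW-UP POINT, limit of the level centres
  (`tendsto_centre`, `‖limitCentre - centre n‖ ≤ D λ/(λ-1) · λ⁻ⁿ`), inside the blow-up ball.
* `Cascade.exists_speed_ge_mag` — the level floors at full strength: at the start time of level `n`
  the witness has speed `≥ c · U_n · λⁿ` within `R λ⁻ⁿ` of `centre n`.
* **`Cascade.isSingularTime`** (UNCONDITIONAL): `(T*, limitCentre)` is not a regular point —
  `‖u‖_{L^∞(Q_r(T*, limitCentre))} = ∞` on every backward parabolic cylinder (floor points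
  `(start n, x_n) → (T*, limitCentre)` with speeds `→ ∞`, joint continuity before `T*`).
* **The Type-I quantity along the clock** (`typeI_quantity_ge`): `T* - start n ≥ dur n = T_n/λ^{2n}`
  gives `√(T* - start n) · ‖u(start n, x_n)‖ ≥ c · U_n · √T_n` (level Reynolds number × square root
  of the hand-over time in the level's own clock). Hence `¬ IsTypeIBlowup` as soon as `U_n √T_n` is
  unbounded (`not_isTypeIBlowup_of_frequently`), in particular under a TURNOVER FLOOR `T_n ≥ θ/U_n`
  for large `n` — every transfer takes at least the fraction `θ` of one turnover `1/U_n` of its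
  level — since then `U_n √T_n ≥ √(θ U_n) → ∞`; so **`Cascade.isTypeIIBlowup_of_turnover_floor`**.
* At the door: `TriggerScheme.exists_witness_isSingularTime_of_transfers` (v1),
  `TriggerSchemeH1.…_of_transfers` / `…_of_transfersSeeded` (v2).

Reading (not a theorem): the door TYPE bounds the hand-over time only from ABOVE
(`T ≤ C_τ (1 + |log ε|)^q / U`), so Type I is not excluded by bookkeeping alone — the dimensional
borderline is `T_n ≍ ν/U_n²` (`o(1)` turnovers), where `U_n √T_n` stays bounded. Every MODEL design of
the lane reads its transfer instant `τ*` in host-turnover units (`τ* = O(1)`, PREREG-FC-TRIG-1 and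
-2), i.e. sits above a turnover floor: the blow-up door N1-FC would produce from such a design is
Type II — consistent with the FC-AUDIT ledger (`GadgetLedger`: `η λ > m` ⇔ level Reynolds numbers
climb; `η λ = m` is the self-similar / Type-I scaling) and with Tao's remark that the averaged blow-up
is Type II (J. Amer. Math. Soc. 29 (2016), p. 8, footnote).

References: T. Tao, J. Amer. Math. Soc. 29 (2016) 601–674, §1.3 [cite: Tao2016AveragedNS, §1.3];
G. Seregin, arXiv:1104.3615 (2012), §1 [cite: Seregin2012, §1]; L. Caffarelli, R. Kohn, L. Nirenberg,
Comm. Pure Appl. Math. 35 (1982), §6 [cite: CaffarelliKohnNirenberg1982, §6]; J. Leray, Acta Math. 63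
(1934) §20 [cite: Leray1934, §20]. 0 sorry; axioms ⊆ {propext, Classical.choice, Quot.sound}.
-/

noncomputable section

namespace Summit.NavierStokesRegularity.FluidComputer.TriggeredTransfer

open Set Filter Function MeasureTheory Metric
open scoped Topology ENNReal
open Literature.Analysis.FluidPDE
open Literature.Analysis.FluidPDE.FluidComputer (E3 Vel)
open Summit.NavierStokesRegularity.FluidComputer.PalasekTowerClayBridge (BreakdownWitness)

namespace TriggerScheme

/-! ## Constants: the geometric series of the centre displacements -/

/-- The geometric majorant `D (λ⁻¹)ᵏ` of the displacements is summable. [folklore] -/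
theorem summable_D_mul_lam_inv_pow (𝒮 : TriggerScheme) : Summable (fun k : ℕ => 𝒮.D * 𝒮.lam⁻¹ ^ k) :=
  (summable_geometric_of_lt_one (inv_nonneg.2 𝒮.lam_pos.le) (inv_lt_one_of_one_lt₀ 𝒮.one_lt_lam)).mul_left 𝒮.D

/-- The geometric tail: `Σ' i, D (λ⁻¹)^(i+n) = D · λ/(λ-1) · (mag n)⁻¹`. [folklore] -/
theorem tsum_D_mul_lam_inv_pow_add (𝒮 : TriggerScheme) (n : ℕ) :
    ∑' i : ℕ, 𝒮.D * 𝒮.lam⁻¹ ^ (i + n) = 𝒮.D * (𝒮.lam / (𝒮.lam - 1)) * (𝒮.mag n)⁻¹ := by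
  have h0 : 0 ≤ 𝒮.lam⁻¹ := inv_nonneg.2 𝒮.lam_pos.le
  have h1 : 𝒮.lam⁻¹ < 1 := inv_lt_one_of_one_lt₀ 𝒮.one_lt_lam
  have hlam : 𝒮.lam ≠ 0 := 𝒮.lam_pos.ne'
  have hgeo : ∑' i : ℕ, 𝒮.lam⁻¹ ^ i = 𝒮.lam / (𝒮.lam - 1) := by
    rw [tsum_geometric_of_lt_one h0 h1]
    have h : 1 - 𝒮.lam⁻¹ = (𝒮.lam - 1) / 𝒮.lam := by field_simp
    rw [h, inv_div]
  simp_rw [pow_add, ← mul_assoc, mul_comm (𝒮.D * _) (𝒮.lam⁻¹ ^ n), mul_assoc]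
  rw [tsum_mul_left, tsum_mul_left, hgeo, 𝒮.mag_inv]
  ring

/-- `(mag n)⁻¹ → 0`. [folklore] -/
theorem tendsto_mag_inv (𝒮 : TriggerScheme) : Tendsto (fun n => (𝒮.mag n)⁻¹) atTop (𝓝 0) := by
  simp_rw [𝒮.mag_inv]
  exact tendsto_pow_atTop_nhds_zero_of_lt_one (inv_nonneg.2 𝒮.lam_pos.le)
    (inv_lt_one_of_one_lt₀ 𝒮.one_lt_lam)

namespace Cascade

variable {𝒮 : TriggerScheme} {ν : ℝ}

/-! ## The limit centre (the blow-up point) -/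

/-- Each hand-over displaces the physical centre by at most `D λ⁻ᵏ`: `‖(mag k)⁻¹ • x₀_k‖ ≤ D (λ⁻¹)ᵏ`. [folklore] -/
theorem norm_mag_inv_smul_x₀_le (ρ : 𝒮.Cascade ν) (k : ℕ) :
    ‖(𝒮.mag k)⁻¹ • (ρ.link k).x₀‖ ≤ 𝒮.D * 𝒮.lam⁻¹ ^ k := by
  rw [norm_smul, Real.norm_of_nonneg (inv_nonneg.2 (𝒮.mag_pos k).le), mul_comm, 𝒮.mag_inv]
  exact mul_le_mul_of_nonneg_right (ρ.link k).norm_x₀_le (pow_nonneg (inv_nonneg.2 𝒮.lam_pos.le) k)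

/-- The displacements of the centres are (absolutely) summable. [folklore] -/
theorem summable_mag_inv_smul_x₀ (ρ : 𝒮.Cascade ν) :
    Summable (fun k : ℕ => (𝒮.mag k)⁻¹ • (ρ.link k).x₀) :=
  Summable.of_norm_bounded 𝒮.summable_D_mul_lam_inv_pow ρ.norm_mag_inv_smul_x₀_le

/-- **The limit centre** (the blow-up point of the cascade, physical space):
`Σ' k, (mag k)⁻¹ • x₀_k`, the limit of the level centres `centre n = Σ_{k<n} (mag k)⁻¹ • x₀_k`. [folklore] -/
def limitCentre (ρ : 𝒮.Cascade ν) : E3 := ∑' k, (𝒮.mag k)⁻¹ • (ρ.link k).x₀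

/-- The level centres converge to the limit centre. [folklore] -/
theorem tendsto_centre (ρ : 𝒮.Cascade ν) : Tendsto ρ.centre atTop (𝓝 ρ.limitCentre) :=
  ρ.summable_mag_inv_smul_x₀.hasSum.tendsto_sum_nat

/-- Splitting off the first `n` displacements: `limitCentre = centre n + Σ' i, (mag (i+n))⁻¹ • x₀_(i+n)`. [folklore] -/
theorem limitCentre_eq_centre_add (ρ : 𝒮.Cascade ν) (n : ℕ) :
    ρ.limitCentre = ρ.centre n + ∑' i, (𝒮.mag (i + n))⁻¹ • (ρ.link (i + n)).x₀ :=
  (ρ.summable_mag_inv_smul_x₀.sum_add_tsum_nat_add n).symm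

/-- **The centres approach the limit centre geometrically**: `‖limitCentre - centre n‖ ≤ D·λ/(λ-1)·(mag n)⁻¹`. [folklore] -/
theorem norm_limitCentre_sub_centre_le (ρ : 𝒮.Cascade ν) (n : ℕ) :
    ‖ρ.limitCentre - ρ.centre n‖ ≤ 𝒮.D * (𝒮.lam / (𝒮.lam - 1)) * (𝒮.mag n)⁻¹ := by
  rw [ρ.limitCentre_eq_centre_add n, add_sub_cancel_left, ← 𝒮.tsum_D_mul_lam_inv_pow_add n]
  have hg : Summable (fun i : ℕ => 𝒮.D * 𝒮.lam⁻¹ ^ (i + n)) :=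
    (summable_nat_add_iff n).2 𝒮.summable_D_mul_lam_inv_pow
  have hle : ∀ i : ℕ, ‖(𝒮.mag (i + n))⁻¹ • (ρ.link (i + n)).x₀‖ ≤ 𝒮.D * 𝒮.lam⁻¹ ^ (i + n) :=
    fun i => ρ.norm_mag_inv_smul_x₀_le (i + n)
  have hnorm : Summable (fun i : ℕ => ‖(𝒮.mag (i + n))⁻¹ • (ρ.link (i + n)).x₀‖) :=
    hg.of_nonneg_of_le (fun i => norm_nonneg _) hle
  exact (norm_tsum_le_tsum_norm hnorm).trans (hnorm.tsum_le_tsum hle hg)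

/-- The limit centre lies in the ball of the centres: `‖limitCentre‖ ≤ D · λ/(λ-1)`. [folklore] -/
theorem norm_limitCentre_le (ρ : 𝒮.Cascade ν) : ‖ρ.limitCentre‖ ≤ 𝒮.D * (𝒮.lam / (𝒮.lam - 1)) := by
  simpa [ρ.centre_zero, 𝒮.mag_zero] using ρ.norm_limitCentre_sub_centre_le 0

/-- A point within `R (mag n)⁻¹` of `centre n` is within `ballRadius · (mag n)⁻¹` of the limit centre. [folklore] -/
theorem dist_limitCentre_le_of_dist_centre_le (ρ : 𝒮.Cascade ν) (n : ℕ) {x : E3}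
    (hx : dist x (ρ.centre n) ≤ 𝒮.R * (𝒮.mag n)⁻¹) :
    dist x ρ.limitCentre ≤ 𝒮.ballRadius * (𝒮.mag n)⁻¹ := by
  calc dist x ρ.limitCentre ≤ dist x (ρ.centre n) + dist (ρ.centre n) ρ.limitCentre := dist_triangle _ _ _
    _ ≤ 𝒮.R * (𝒮.mag n)⁻¹ + 𝒮.D * (𝒮.lam / (𝒮.lam - 1)) * (𝒮.mag n)⁻¹ := by
        refine add_le_add hx ?_
        rw [dist_eq_norm, ← norm_neg, neg_sub]
        exact ρ.norm_limitCentre_sub_centre_le n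
    _ = 𝒮.ballRadius * (𝒮.mag n)⁻¹ := by rw [ballRadius]; ring

/-! ## The level floors at full strength, and the clock from below -/

/-- **The velocity floors survive the zoom, at full strength**: at the start time of level `n` the
witness has speed at least `c · U_n · λⁿ` at a point within `R λ⁻ⁿ` of the level centre (the zoomed
image of the floor point of the level state `w n`). [folklore] -/
theorem exists_speed_ge_mag (ρ : 𝒮.Cascade ν) (hν : 0 < ν) (n : ℕ) :
    ∃ x : E3, dist x (ρ.centre n) ≤ 𝒮.R * (𝒮.mag n)⁻¹ ∧
      𝒮.c * ρ.U n * 𝒮.mag n ≤ ‖ρ.limitVel hν (ρ.start n) x‖ := by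
  obtain ⟨y, hyR, hfloor⟩ := ρ.exists_floor n
  refine ⟨ρ.centre n + (𝒮.mag n)⁻¹ • y, ?_, ?_⟩
  · rw [dist_eq_norm, add_sub_cancel_left, norm_smul,
      Real.norm_of_nonneg (inv_nonneg.2 (𝒮.mag_pos n).le), mul_comm]
    exact mul_le_mul_of_nonneg_right hyR (inv_nonneg.2 (𝒮.mag_pos n).le)
  · rw [ρ.limitVel_eq_gvel hν (ρ.start_lt_stop n), ρ.gvel_apply_start, ρ.vel_start, zoom_apply,
      add_sub_cancel_left, smul_smul, mul_inv_cancel₀ (𝒮.mag_pos n).ne', one_smul, norm_smul,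
      Real.norm_of_nonneg (𝒮.mag_pos n).le, mul_comm (𝒮.mag n)]
    exact mul_le_mul_of_nonneg_right hfloor (𝒮.mag_pos n).le

/-- **The clock from below**: level `n` is followed by at least its own duration, `dur n ≤ T* - start n`. [folklore] -/
theorem dur_le_Tstar_sub_start (ρ : 𝒮.Cascade ν) (hν : 0 < ν) (n : ℕ) :
    ρ.dur n ≤ ρ.Tstar - ρ.start n := by
  rw [ρ.Tstar_eq_start_add hν n, add_sub_cancel_left]
  have hs : Summable (fun i : ℕ => ρ.dur (i + n)) := (summable_nat_add_iff n).2 (ρ.summable_dur hν)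
  simpa using hs.le_tsum 0 (fun j _ => (ρ.dur_pos _).le)

/-- `√(dur n) = √T_n / mag n`. [folklore] -/
theorem sqrt_dur (ρ : 𝒮.Cascade ν) (n : ℕ) : Real.sqrt (ρ.dur n) = Real.sqrt (ρ.link n).T / 𝒮.mag n := by
  rw [dur, Real.sqrt_div' _ (sq_nonneg _), Real.sqrt_sq (𝒮.mag_pos n).le]

/-- **The Type-I quantity along the clock.** At the start time of level `n`, at the floor point
`x_n` (within `ballRadius · λ⁻ⁿ` of the limit centre):
`c · U_n · √T_n ≤ √(T* - start n) · ‖u(start n, x_n)‖` — the level Reynolds number times the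
square root of the level's hand-over time in its own clock. [folklore] -/
theorem typeI_quantity_ge (ρ : 𝒮.Cascade ν) (hν : 0 < ν) (n : ℕ) :
    ∃ x : E3, dist x ρ.limitCentre ≤ 𝒮.ballRadius * (𝒮.mag n)⁻¹ ∧
      𝒮.c * ρ.U n * Real.sqrt (ρ.link n).T ≤
        Real.sqrt (ρ.Tstar - ρ.start n) * ‖ρ.limitVel hν (ρ.start n) x‖ := by
  obtain ⟨x, hx, hspeed⟩ := ρ.exists_speed_ge_mag hν n
  refine ⟨x, ρ.dist_limitCentre_le_of_dist_centre_le n hx, ?_⟩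
  have hsqrt : Real.sqrt (ρ.link n).T / 𝒮.mag n ≤ Real.sqrt (ρ.Tstar - ρ.start n) := by
    rw [← ρ.sqrt_dur n]
    exact Real.sqrt_le_sqrt (ρ.dur_le_Tstar_sub_start hν n)
  have hm := 𝒮.mag_pos n
  calc 𝒮.c * ρ.U n * Real.sqrt (ρ.link n).T
        = (Real.sqrt (ρ.link n).T / 𝒮.mag n) * (𝒮.c * ρ.U n * 𝒮.mag n) := by
          field_simp
    _ ≤ Real.sqrt (ρ.Tstar - ρ.start n) * ‖ρ.limitVel hν (ρ.start n) x‖ :=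
          mul_le_mul hsqrt hspeed (mul_pos (mul_pos 𝒮.c_pos (ρ.U_pos n)) hm).le (Real.sqrt_nonneg _)

/-! ## Not Type I -/

/-- The start times tend to `T*` FROM BELOW. [folklore] -/
theorem tendsto_start_nhdsWithin (ρ : 𝒮.Cascade ν) (hν : 0 < ν) :
    Tendsto ρ.start atTop (𝓝[<] ρ.Tstar) :=
  tendsto_nhdsWithin_iff.2 ⟨ρ.tendsto_start hν, Eventually.of_forall fun n => ρ.start_lt_Tstar hν n⟩

/-- **A cascade whose levels keep `U_n √T_n` unbounded is not a Type-I blow-up**: if for every `C`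
there are arbitrarily large levels with `C < U_n √T_n`, then the self-similar rate
`‖u(t, x)‖ ≤ C'/√(T* - t)` fails near `T*` (at the floor points of those levels,
`typeI_quantity_ge`). [cite: Seregin2012, §1] -/
theorem not_isTypeIBlowup_of_frequently (ρ : 𝒮.Cascade ν) (hν : 0 < ν)
    (h : ∀ C : ℝ, ∃ᶠ n in atTop, C < ρ.U n * Real.sqrt (ρ.link n).T) :
    ¬ IsTypeIBlowup (ρ.limitVel hν) ρ.Tstar := by
  rintro ⟨C, hC⟩
  have hev : ∀ᶠ n in atTop, ∀ x, ‖ρ.limitVel hν (ρ.start n) x‖ ≤ C / Real.sqrt (ρ.Tstar - ρ.start n) :=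
    (ρ.tendsto_start_nhdsWithin hν).eventually hC
  obtain ⟨n, hn, hlt⟩ := (hev.and_frequently (h (C / 𝒮.c))).exists
  obtain ⟨x, -, hx⟩ := ρ.typeI_quantity_ge hν n
  have hpos : 0 < Real.sqrt (ρ.Tstar - ρ.start n) := Real.sqrt_pos.2 (sub_pos.2 (ρ.start_lt_Tstar hν n))
  have h1 : Real.sqrt (ρ.Tstar - ρ.start n) * ‖ρ.limitVel hν (ρ.start n) x‖ ≤ C := by
    rw [mul_comm]; exact (le_div_iff₀ hpos).1 (hn x)
  have h2 : C < 𝒮.c * (ρ.U n * Real.sqrt (ρ.link n).T) := by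
    rw [mul_comm]; exact (div_lt_iff₀ 𝒮.c_pos).1 hlt
  linarith [mul_assoc 𝒮.c (ρ.U n) (Real.sqrt (ρ.link n).T)]

/-- Under a turnover floor the clock quantity dominates `√(θ U_n)`: `θ/U_n ≤ T_n ⇒ √(θ U_n) ≤ U_n √T_n`. [folklore] -/
theorem sqrt_mul_le_of_turnover_floor (ρ : 𝒮.Cascade ν) {θ : ℝ} {n : ℕ} (hfloor : θ / ρ.U n ≤ (ρ.link n).T) :
    Real.sqrt (θ * ρ.U n) ≤ ρ.U n * Real.sqrt (ρ.link n).T := by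
  have hU := ρ.U_pos n
  have hsq : ρ.U n * Real.sqrt (ρ.link n).T = Real.sqrt (ρ.U n ^ 2 * (ρ.link n).T) := by
    rw [Real.sqrt_mul (sq_nonneg _), Real.sqrt_sq hU.le]
  rw [hsq]
  refine Real.sqrt_le_sqrt ?_
  have h1 : θ ≤ ρ.U n * (ρ.link n).T := by rwa [div_le_iff₀' hU] at hfloor
  nlinarith

/-- **A TURNOVER FLOOR makes the blow-up non-Type-I.** If, for large `n`, the transfer of level `n`
takes at least the fixed fraction `θ > 0` of one turnover time of its level, `θ / U_n ≤ T_n` (unit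
scale, amplitude `U_n`), then `U_n √T_n ≥ √(θ U_n) → ∞` and the witness is not a Type-I blow-up at
`T*`. [cite: Seregin2012, §1] -/
theorem not_isTypeIBlowup_of_turnover_floor (ρ : 𝒮.Cascade ν) (hν : 0 < ν) {θ : ℝ} (hθ : 0 < θ)
    (hfloor : ∀ᶠ n in atTop, θ / ρ.U n ≤ (ρ.link n).T) :
    ¬ IsTypeIBlowup (ρ.limitVel hν) ρ.Tstar := by
  refine ρ.not_isTypeIBlowup_of_frequently hν fun C => ?_
  have hdiv : Tendsto (fun n => Real.sqrt (θ * ρ.U n)) atTop atTop :=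
    Real.tendsto_sqrt_atTop.comp (ρ.tendsto_U.const_mul_atTop hθ)
  exact ((hdiv.eventually_gt_atTop C).and hfloor).frequently.mono
    fun n hn => hn.1.trans_le (ρ.sqrt_mul_le_of_turnover_floor hn.2)

/-! ## A singular time at the limit centre -/

/-- **Floor points inside every backward cylinder, with arbitrarily large speed.** For `r > 0` and
every bound `M`, some level `n ≥ 1` has its floor point `(start n, x_n)` in the backward parabolic
cylinder `Q_r(T*, limitCentre)` with `‖u(start n, x_n)‖ > M` (start times `↑ T*`, floor points
within `ballRadius λ⁻ⁿ → 0` of the limit centre, speeds `≥ c U_n λⁿ → ∞`). [folklore] -/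
theorem exists_mem_parabolicCylinder_lt_norm (ρ : 𝒮.Cascade ν) (hν : 0 < ν) {r : ℝ} (hr : 0 < r) (M : ℝ) :
    ∃ z ∈ parabolicCylinder r (ρ.Tstar, ρ.limitCentre), 0 < z.1 ∧ M < ‖uncurry (ρ.limitVel hν) z‖ := by
  have h1 : ∀ᶠ n in atTop, ρ.Tstar - r ^ 2 < ρ.start n :=
    (ρ.tendsto_start hν).eventually (eventually_gt_nhds (by nlinarith))
  have h2 : ∀ᶠ n in atTop, 𝒮.ballRadius * (𝒮.mag n)⁻¹ < r := by
    have ht : Tendsto (fun n => 𝒮.ballRadius * (𝒮.mag n)⁻¹) atTop (𝓝 0) := by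
      simpa using 𝒮.tendsto_mag_inv.const_mul 𝒮.ballRadius
    exact ht.eventually (eventually_lt_nhds hr)
  have h3 : ∀ᶠ n in atTop, M < 𝒮.c * ρ.U n * 𝒮.mag n := by
    have ht : Tendsto (fun n => 𝒮.c * ρ.U n) atTop atTop := ρ.tendsto_U.const_mul_atTop 𝒮.c_pos
    refine (ht.eventually_gt_atTop M).mono fun n hn => hn.trans_le ?_
    exact le_mul_of_one_le_right (mul_pos 𝒮.c_pos (ρ.U_pos n)).le (𝒮.one_le_mag n)
  obtain ⟨n, ⟨hn1, hn2⟩, hn3, hn4⟩ := ((h1.and h2).and (h3.and (eventually_ge_atTop 1))).exists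
  obtain ⟨x, hx, hspeed⟩ := ρ.exists_speed_ge_mag hν n
  refine ⟨(ρ.start n, x), ?_, ?_, hn3.trans_le hspeed⟩
  · rw [mem_parabolicCylinder]
    exact ⟨⟨hn1, ρ.start_lt_Tstar hν n⟩,
      ((ρ.dist_limitCentre_le_of_dist_centre_le n hx).trans_lt hn2)⟩
  · calc (0 : ℝ) = ρ.start 0 := ρ.start_zero.symm
      _ < ρ.start n := ρ.strictMono_start (Nat.one_le_iff_ne_zero.1 hn4 |> Nat.pos_of_ne_zero)

/-- The witness is jointly continuous at every space–time point with `0 < t < T*`. [folklore] -/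
theorem continuousAt_uncurry_limitVel (ρ : 𝒮.Cascade ν) (hν : 0 < ν) {z : ℝ × E3}
    (h0 : 0 < z.1) (hT : z.1 < ρ.Tstar) : ContinuousAt (uncurry (ρ.limitVel hν)) z := by
  have hcont : ContinuousOn (uncurry (ρ.limitVel hν)) (Ico 0 ρ.Tstar ×ˢ univ) :=
    (ρ.limit_classical hν).smooth_velocity.continuousOn
  obtain ⟨t, x⟩ := z
  exact hcont.continuousAt
    (prod_mem_nhds (mem_of_superset (Ioo_mem_nhds h0 hT) Ioo_subset_Ico_self) univ_mem)

/-- **`L^∞ = ∞` on every backward cylinder at the limit centre**: for `r > 0`,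
`‖u‖_{L^∞(Q_r(T*, limitCentre))} = ∞` (essential supremum w.r.t. space–time Lebesgue measure):
around a floor point with speed `> M` inside the (open) cylinder, joint continuity gives a
neighbourhood of positive measure where the speed exceeds `M`. [cite: CaffarelliKohnNirenberg1982, §6] -/
theorem eLpNorm_parabolicCylinder_eq_top (ρ : 𝒮.Cascade ν) (hν : 0 < ν) {r : ℝ} (hr : 0 < r) :
    eLpNorm (uncurry (ρ.limitVel hν)) ∞
      (volume.restrict (parabolicCylinder r (ρ.Tstar, ρ.limitCentre))) = ∞ := by
  set Q : Set (ℝ × E3) := parabolicCylinder r (ρ.Tstar, ρ.limitCentre) with hQ_def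
  set u := uncurry (ρ.limitVel hν) with hu_def
  by_contra hne
  set K : ℝ≥0∞ := eLpNorm u ∞ (volume.restrict Q) with hK_def
  have hKtop : K ≠ ⊤ := hne
  obtain ⟨z₀, hz₀Q, hz₀pos, hz₀M⟩ := ρ.exists_mem_parabolicCylinder_lt_norm hν hr K.toReal
  have hz₀T : z₀.1 < ρ.Tstar := by
    have := (mem_parabolicCylinder.1 hz₀Q).1.2
    simpa using this
  have hcont : ContinuousAt u z₀ := ρ.continuousAt_uncurry_limitVel hν hz₀pos hz₀T
  have hnhds : {z | z ∈ Q ∧ K.toReal < ‖u z‖} ∈ 𝓝 z₀ := by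
    refine inter_mem ((isOpen_parabolicCylinder r _).mem_nhds hz₀Q) ?_
    exact hcont.norm.eventually_const_lt hz₀M
  have hposA : 0 < volume {z | z ∈ Q ∧ K.toReal < ‖u z‖} :=
    Measure.measure_pos_of_mem_nhds volume hnhds
  have hae : ∀ᵐ z ∂(volume.restrict Q), ‖u z‖ₑ ≤ K := by
    rw [hK_def, eLpNorm_exponent_top]
    exact ae_le_eLpNormEssSup
  have hQm : MeasurableSet Q := (isOpen_parabolicCylinder r _).measurableSet
  rw [ae_restrict_iff' hQm] at hae
  have hzero : volume {z | ¬ (z ∈ Q → ‖u z‖ₑ ≤ K)} = 0 := ae_iff.1 hae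
  have hsub : {z | z ∈ Q ∧ K.toReal < ‖u z‖} ⊆ {z | ¬ (z ∈ Q → ‖u z‖ₑ ≤ K)} := by
    intro z hz hz'
    have hle : ‖u z‖ₑ ≤ K := hz' hz.1
    have hlt : K < ‖u z‖ₑ := by
      rw [← ENNReal.ofReal_toReal hKtop, ← ofReal_norm]
      exact (ENNReal.ofReal_lt_ofReal_iff (lt_of_le_of_lt ENNReal.toReal_nonneg hz.2)).2 hz.2
    exact (hlt.trans_le hle).false
  exact (lt_irrefl (0 : ℝ≥0∞)) (hposA.trans_le ((measure_mono hsub).trans hzero.le))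

/-- **The limit centre is a singular point at `T*`**: `(T*, limitCentre)` is not a regular point of
the witness in the sense of Caffarelli–Kohn–Nirenberg (essentially unbounded on every centred
parabolic cylinder `Q*_r`, already on the backward halves `Q_r ⊆ Q*_r`). [cite: CaffarelliKohnNirenberg1982, §6] -/
theorem not_isRegularPoint_limitCentre (ρ : 𝒮.Cascade ν) (hν : 0 < ν) :
    ¬ IsRegularPoint (ρ.limitVel hν) (ρ.Tstar, ρ.limitCentre) := by
  rintro ⟨r, hr, hlt⟩
  have hmono : eLpNorm (uncurry (ρ.limitVel hν)) ∞
        (volume.restrict (parabolicCylinder r (ρ.Tstar, ρ.limitCentre))) ≤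
      eLpNorm (uncurry (ρ.limitVel hν)) ∞
        (volume.restrict (parabolicCylinderCentered r (ρ.Tstar, ρ.limitCentre))) :=
    eLpNorm_mono_measure _ (Measure.restrict_mono (parabolicCylinder_subset_centered r _) le_rfl)
  rw [ρ.eLpNorm_parabolicCylinder_eq_top hν hr, top_le_iff] at hmono
  exact hlt.ne hmono

/-- **`T*` is a singular time of the cascade's witness** (Seregin 2012, §1), UNCONDITIONALLY: the
limit centre is a singular point. [cite: Seregin2012, §1] -/
theorem isSingularTime (ρ : 𝒮.Cascade ν) (hν : 0 < ν) : IsSingularTime (ρ.limitVel hν) ρ.Tstar :=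
  ⟨ρ.limitCentre, ρ.not_isRegularPoint_limitCentre hν⟩

/-! ## Type II -/

/-- **Type II from an unbounded clock quantity**: if `U_n √T_n` is unbounded along the levels (for
every `C`, frequently `C < U_n √T_n`), the witness is a Type II blow-up at `T*`
(singular time ∧ ¬ Type I). [cite: Seregin2012, §1] -/
theorem isTypeIIBlowup_of_frequently (ρ : 𝒮.Cascade ν) (hν : 0 < ν)
    (h : ∀ C : ℝ, ∃ᶠ n in atTop, C < ρ.U n * Real.sqrt (ρ.link n).T) :
    IsTypeIIBlowup (ρ.limitVel hν) ρ.Tstar :=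
  ⟨ρ.isSingularTime hν, ρ.not_isTypeIBlowup_of_frequently hν h⟩

/-- **TURNOVER FLOOR ⇒ TYPE II.** If, for large `n`, every transfer takes at least the fixed fraction
`θ > 0` of one turnover of its level, `θ / U_n ≤ T_n`, then the blow-up of the cascade's witness at
`T*` is of Type II in the sense of Seregin 2012, §1: `T*` is a singular time and the Type-I rate
`‖u(t, x)‖ ≤ C/√(T* - t)` fails near `T*` for every `C`. [cite: Seregin2012, §1] -/
theorem isTypeIIBlowup_of_turnover_floor (ρ : 𝒮.Cascade ν) (hν : 0 < ν) {θ : ℝ} (hθ : 0 < θ)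
    (hfloor : ∀ᶠ n in atTop, θ / ρ.U n ≤ (ρ.link n).T) :
    IsTypeIIBlowup (ρ.limitVel hν) ρ.Tstar :=
  ⟨ρ.isSingularTime hν, ρ.not_isTypeIBlowup_of_turnover_floor hν hθ hfloor⟩

/-- The same for a floor holding at EVERY level. [cite: Seregin2012, §1] -/
theorem isTypeIIBlowup_of_forall_turnover_floor (ρ : 𝒮.Cascade ν) (hν : 0 < ν) {θ : ℝ} (hθ : 0 < θ)
    (hfloor : ∀ n, θ / ρ.U n ≤ (ρ.link n).T) :
    IsTypeIIBlowup (ρ.limitVel hν) ρ.Tstar :=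
  ρ.isTypeIIBlowup_of_turnover_floor hν hθ (Eventually.of_forall hfloor)

end Cascade

/-! ## At the door: every transferring scheme yields a witness blowing up at a SINGULAR TIME -/

/-- **Door v1.** A transferring scheme (`TriggerScheme.Transfers ν`, `ν > 0`) yields an exact forced
Clay-class blow-up whose blow-up time is a singular time of its velocity (a CKN-singular point at the
limit centre of its cascade); under a turnover floor on that cascade it is moreover Type II
(`Cascade.isTypeIIBlowup_of_turnover_floor`). [cite: Seregin2012, §1] -/
theorem exists_witness_isSingularTime_of_transfers (𝒮 : TriggerScheme) {ν : ℝ} (hν : 0 < ν)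
    (hT : 𝒮.Transfers ν) : ∃ W : BreakdownWitness ν, IsSingularTime W.u W.T := by
  obtain ⟨ρ⟩ := 𝒮.nonempty_cascade_of_transfers hν hT
  exact ⟨ρ.toWitness hν, ρ.isSingularTime hν⟩

end TriggerScheme

namespace TriggerSchemeH1

/-- **Door v2** (`H¹` alphabet above ignition). A transferring scheme (`TriggerSchemeH1.Transfers ν`,
`ν > 0`) yields an exact forced Clay-class blow-up whose blow-up time is a singular time of its
velocity. [cite: Seregin2012, §1] -/
theorem exists_witness_isSingularTime_of_transfers (𝒮 : TriggerSchemeH1) {ν : ℝ} (hν : 0 < ν)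
    (hT : 𝒮.Transfers ν) : ∃ W : BreakdownWitness ν, IsSingularTime W.u W.T := by
  obtain ⟨ρ⟩ := 𝒮.nonempty_cascade hν hT
  exact ⟨ρ.toWitness hν, ρ.isSingularTime hν⟩

/-- **Seeded door v2** (transfers with the level seeds only). The same conclusion from
`TriggerSchemeH1.TransfersSeeded ν`. [cite: Seregin2012, §1] -/
theorem exists_witness_isSingularTime_of_transfersSeeded (𝒮 : TriggerSchemeH1) {ν : ℝ} (hν : 0 < ν)
    (hT : 𝒮.TransfersSeeded ν) : ∃ W : BreakdownWitness ν, IsSingularTime W.u W.T := by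
  obtain ⟨ρ⟩ := 𝒮.nonempty_cascade_of_seeded hT
  exact ⟨ρ.toWitness hν, ρ.isSingularTime hν⟩

end TriggerSchemeH1

end Summit.NavierStokesRegularity.FluidComputer.TriggeredTransfer

end
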